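import Literature.Probability.RandomPlanarGeometry.SLESixMoebiusLocalityProofs
import Literature.Probability.RandomPlanarGeometry.SLESixSplittingReduction
import HarnessLib

/-!
# Discharges of named facts of `SLESixSplitting.lean`

`Literature/Probability/RandomPlanarGeometry/SLESixSplittingHolds.lean` — proofs-only sibling
of `SLESixSplitting.lean` (no definitions, no named facts). Each theorem below closes a named
fact `X : Prop` of that file as `X_holds : X` by composing an ACCEPTED reduction theorem of
the tree with the ACCEPTED unconditional `_holds` discharges of all of its hypotheses; nothing
is re-proved and no statement is changed. Recorded by the librarian sweep g25 (2026-08-16,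
pass 5c: facts dischargeable in one line from the tree's own lemmas), so that the facts
census, `#h21_route_deps` and the cone guardrail see these facts as theorems.

Discharged here:

* `targetIndependence_six_holds` := `targetIndependence_six_of_moebius`
  `sle_six_moebius_locality_holds` (`SLESixSplittingReduction.lean`).

## References

* [Werner2007] — see `lean/references.bib` and the docstring of the fact in `SLESixSplitting.lean`.
-/

namespace Literature.Probability.RandomPlanarGeometry.IsSLELaw

/-- **Discharge of the named fact `targetIndependence_six`** (`SLESixSplitting.lean`): NAMED FACT
— the splitting property (target independence) of chordal SLE₆ (Lawler–Schramm–Werner (2001),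
Cor. 2.3: … — obtained as `targetIndependence_six_of_moebius` applied to the tree's
unconditional discharge `sle_six_moebius_locality_holds` of its hypothesis (reduction in
`SLESixSplittingReduction.lean`).
[cite: Werner2007, Prop. 3.4] -/
theorem targetIndependence_six_holds :
    targetIndependence_six :=
  targetIndependence_six_of_moebius
    Literature.Probability.RandomPlanarGeometry.sle_six_moebius_locality_holds

end Literature.Probability.RandomPlanarGeometry.IsSLELaw
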